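import Mathlib
import Literature.NumberTheory.LFunctions.Zhang2022.Section10Range1321Mid
import Literature.NumberTheory.LFunctions.Zhang2022.SkeletonLemma84Rel
import Literature.NumberTheory.LFunctions.Zhang2022.Section10Lemma101
import HarnessLib

/-!
# Zhang (2022) §10, `Θ₁(𝐚₁₃,𝐚₂₁)`: the middle range `P^{0.5} ≤ dr < P^{0.502}` — node
# `Z22:§10.u043` (first line) from Lemma 10.1 and the RELATIVE Lemma 8.4

Topic `Literature/NumberTheory/LFunctions/Zhang2022` (Landau–Siegel audit tree; verdict-neutral).
Y. Zhang, *Discrete mean estimates and the Landau–Siegel zero*, arXiv:2211.02515v1 (2022)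
[Zhang2022LandauSiegel], §10 p. 58, tex L2986–L2990 — **an unrefereed manuscript under
adjudication; nothing here bears on its Theorems 1–2.** ZHANG-L discharge lane (WP10, seat
zl-w10-p4), input of the leaf `Typed.Sec10B.Concl1321` (hypothesis `hC1321` of
`Skeleton.theorem1_of_leaves_v19`).

**`eq1043a_of_rel : Skeleton.Lemma101 c′ → Skeleton.Lemma84Rel c′ → Typed.Sec10B.Eq1043a c′`** —
the tree edge `Sj1321Mid.eq1043a_of` (L3, `Section10Range1321Mid`) re-pointed from the printed
(absolute, underivable-as-printed: rows G-adj1-1 / G-d55-3) Lemma 8.4 to its RELATIVE form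
`Skeleton.Lemma84Rel` (error `C𝓛⁻⁶·∏_{q∣dr}(1 − q⁻¹)⁻²`, the form the printed contour argument
delivers and the form the skeleton derives from the App. A leaves: `lemma84Rel_of_lemma83Rel`,
`lemma83Rel_of_parts`). The proof is the L3 proof verbatim except at three places: (i) Lemma 8.4's
error at the divisor pair `(n/r, r)` is `e₂·(n/φ(n))²` (`∏_{q∣n}(1 − q⁻¹)⁻¹ = n/φ(n)`,
`prod_one_sub_inv_inv_sq_eq`), uniformly in `r ∣ n`, so the per-`n` estimate
`Sj1321Mid.norm_sum_divisors_le` applies with that error and its bound is rescaled by `(n/φ(n))²`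
(`per_n_scale`); (ii) the window weights are `Σ(n/φ(n))⁹/n` instead of `Σ(n/φ(n))⁷/n`
(`weight_good_le9`, `weight_top_le9`, `weight_point_le9`, from the tree's
`Skeleton.sum_ratio_pow_div_le` at `k = 9`, constant `e^{1024}`); (iii) the final scalar inequality
is `Sj1321Mid.final_le` rescaled by `e^{768}` (`final_le9`). Total error
`≤ 4e^{1024}(K_g + K_e)𝓛⁻¹⁰ = o(α)`.

## References

* Y. Zhang, arXiv:2211.02515v1 (2022), §10 p. 58; Lemma 10.1; §8 Lemma 8.4, (8.10).
  [cite: Zhang2022LandauSiegel, §10 p. 58]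
-/

noncomputable section

open Complex Real Finset ComplexConjugate

namespace Literature.NumberTheory.LFunctions.Zhang2022.Sj1321Mid

open Skeleton Typed.Sec10B

/-- `P > 0`. [cite: Zhang2022LandauSiegel, §2 (2.6)] -/
private theorem bigP_pos₉ (D : ℕ) : 0 < bigP D := Real.exp_pos _

/-- `log P = 𝓛⁹`. [cite: Zhang2022LandauSiegel, §2 (2.6)] -/
private theorem log_bigP₉ (D : ℕ) : Real.log (bigP D) = ell D ^ 9 := by rw [bigP, Real.log_exp]

/-- `log T = 𝓛^{1.1}`. [cite: Zhang2022LandauSiegel, §6 p. 30] -/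
private theorem log_bigT₉ (D : ℕ) : Real.log (bigT D) = ell D ^ (1.1 : ℝ) := by
  rw [Skeleton.bigT, Real.log_exp]

/-- The threshold: `D ≥ ⌈e^{L₀}⌉ ⇒ 𝓛 ≥ L₀`. [cite: Zhang2022LandauSiegel, §2 p. 4] -/
private theorem le_ell_of_ceil_exp_le₄ {L₀ : ℝ} {D : ℕ} (hD : ⌈Real.exp L₀⌉₊ ≤ D) :
    L₀ ≤ ell D := by
  have h1 : Real.exp L₀ ≤ (D : ℝ) := le_trans (Nat.le_ceil _) (by exact_mod_cast hD)
  have h2 := Real.log_le_log (Real.exp_pos _) h1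
  rwa [Real.log_exp] at h2

/-! ## §1. The relative factor and the rescaling of the per-`n` estimate -/

/-- The relative factor of Lemma 8.4 squared is `(n/φ(n))²`: `(∏_{q∣n}(1 − q⁻¹)⁻¹)² = (n/φ(n))²`
(`n ≠ 0`; Euler's product `n/φ(n) = ∏_{q∣n} q/(q−1)`, tree `Skeleton.self_div_totient_eq_prod`).
[cite: Zhang2022LandauSiegel, §8 Lemma 8.4] -/
theorem prod_one_sub_inv_inv_sq_eq {n : ℕ} (hn : n ≠ 0) :
    (∏ q ∈ n.primeFactors, (1 - (q : ℝ)⁻¹)⁻¹) ^ 2 = ((n : ℝ) / Nat.totient n) ^ 2 := by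
  rw [self_div_totient_eq_prod hn]
  congr 1
  refine Finset.prod_congr rfl fun q hq => ?_
  have h2 : (2 : ℝ) ≤ q := by exact_mod_cast (Nat.prime_of_mem_primeFactors hq).two_le
  have hq0 : (q : ℝ) ≠ 0 := by linarith
  have hq1 : (q : ℝ) - 1 ≠ 0 := by linarith
  field_simp

/-- Rescaling of the per-`n` bound of `Sj1321Mid.norm_sum_divisors_le` when Lemma 8.4's error is
`e₂ρ₂` (`ρ₂ = ρ² ≥ 1`, `ρ = n/φ(n)`): `ρ⁷x⁻¹(e₁(e₂ρ₂ + 146Λ′) + Ae₂ρ₂)/L ≤ ρ⁹x⁻¹(e₁(e₂ + 146Λ′) + Ae₂)/L`.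
[cite: Zhang2022LandauSiegel, §10 p. 58] -/
private theorem per_n_scale {ρ ρ2 x e₁ e₂ A Λ' L : ℝ} (hρ2 : ρ ^ 2 = ρ2) (h1 : 1 ≤ ρ2)
    (hρ : 0 ≤ ρ) (he₁ : 0 ≤ e₁) (hΛ : 0 ≤ Λ') (hx : 0 ≤ x) (hL : 0 < L) :
    ρ ^ 7 / x * ((e₁ * (e₂ * ρ2 + 146 * Λ') + A * (e₂ * ρ2)) / L) ≤
      ρ ^ 9 / x * ((e₁ * (e₂ + 146 * Λ') + A * e₂) / L) := by
  have hρ9 : ρ ^ 9 = ρ ^ 7 * ρ2 := by rw [← hρ2]; ring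
  rw [hρ9]
  have hin : e₁ * (e₂ * ρ2 + 146 * Λ') + A * (e₂ * ρ2) ≤ ρ2 * (e₁ * (e₂ + 146 * Λ') + A * e₂) := by
    nlinarith [mul_nonneg (sub_nonneg.mpr h1) (mul_nonneg he₁ hΛ)]
  have h7 : 0 ≤ ρ ^ 7 / x := by positivity
  calc ρ ^ 7 / x * ((e₁ * (e₂ * ρ2 + 146 * Λ') + A * (e₂ * ρ2)) / L)
      ≤ ρ ^ 7 / x * ((ρ2 * (e₁ * (e₂ + 146 * Λ') + A * e₂)) / L) := by
        gcongr
    _ = ρ ^ 7 * ρ2 / x * ((e₁ * (e₂ + 146 * Λ') + A * e₂) / L) := by ring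

/-! ## §2. Window weights `Σ(n/φ(n))⁹/n` -/

/-- The good piece: `Σ_{⌊P^{0.5}⌋ < n ≤ ⌊P^{0.502}/T⌋} (n/φ(n))⁹/n ≤ e^{1024}(2 + 𝓛⁹)` (`𝓛 ≥ 3`).
[cite: Zhang2022LandauSiegel, §10 p. 58] -/
theorem weight_good_le9 {D : ℕ} (hL : 3 ≤ ell D) :
    ∑ n ∈ Finset.Ioc ⌊bigP D ^ (0.5 : ℝ)⌋₊ ⌊bigP D ^ (0.502 : ℝ) / bigT D⌋₊,
        ((n : ℝ) / Nat.totient n) ^ 9 / n ≤ Real.exp 1024 * (2 + ell D ^ 9) := by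
  have hT1 : 1 ≤ bigT D := one_le_bigT D (by linarith)
  have hT0 : 0 < bigT D := by linarith
  have hlo2 : (2 : ℝ) ≤ bigP D ^ (0.5 : ℝ) := by
    rw [bigP_rpow_eq]
    have h9 : (3 : ℝ) ^ 9 ≤ ell D ^ 9 := pow_le_pow_left₀ (by norm_num) hL 9
    have : (1 : ℝ) ≤ ell D ^ 9 * 0.5 := by nlinarith
    calc (2 : ℝ) ≤ 1 + 1 := by norm_num
      _ ≤ (ell D ^ 9 * 0.5) + 1 := by linarith
      _ ≤ Real.exp (ell D ^ 9 * 0.5) := Real.add_one_le_exp _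
  have hhi : bigP D ^ (0.5 : ℝ) ≤ bigP D ^ (0.502 : ℝ) / bigT D := by
    rw [le_div_iff₀ hT0, mul_comm]; exact bigT_mul_rpow_half_le hL
  have hY : 0 < ⌊bigP D ^ (0.5 : ℝ)⌋₊ := Nat.floor_pos.mpr (by linarith)
  have hYX : ⌊bigP D ^ (0.5 : ℝ)⌋₊ ≤ ⌊bigP D ^ (0.502 : ℝ) / bigT D⌋₊ := Nat.floor_mono hhi
  refine (sum_ratio_pow_div_le 9 hY hYX).trans ?_
  have hlogY : Real.log (bigP D ^ (0.5 : ℝ) / 2) ≤ Real.log (⌊bigP D ^ (0.5 : ℝ)⌋₊ : ℕ) := by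
    refine Real.log_le_log (by linarith) ?_
    have := Nat.sub_one_lt_floor (bigP D ^ (0.5 : ℝ))
    linarith
  have hlogX : Real.log (⌊bigP D ^ (0.502 : ℝ) / bigT D⌋₊ : ℕ) ≤
      Real.log (bigP D ^ (0.502 : ℝ)) := by
    refine Real.log_le_log (by exact_mod_cast lt_of_lt_of_le hY hYX) ?_
    have hP2 : 0 ≤ bigP D ^ (0.502 : ℝ) := Real.rpow_nonneg (bigP_pos₉ D).le _
    exact (Nat.floor_le (div_nonneg hP2 hT0.le)).trans (div_le_self hP2 hT1)
  rw [Real.log_div (Real.rpow_pos_of_pos (bigP_pos₉ D) _).ne' (by norm_num),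
    Real.log_rpow (bigP_pos₉ D), log_bigP₉] at hlogY
  rw [Real.log_rpow (bigP_pos₉ D), log_bigP₉] at hlogX
  have hlog2 : Real.log 2 ≤ 1 := by
    have := Real.log_two_lt_d9; linarith
  have h1024 : (2 : ℝ) ^ (9 + 1) = 1024 := by norm_num
  rw [h1024]
  have h9 : 0 ≤ ell D ^ 9 := by positivity
  have hlin : 1 + Real.log (⌊bigP D ^ (0.502 : ℝ) / bigT D⌋₊ : ℕ) -
      Real.log (⌊bigP D ^ (0.5 : ℝ)⌋₊ : ℕ) ≤ 2 + ell D ^ 9 := by linarith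
  exact mul_le_mul_of_nonneg_left hlin (Real.exp_pos _).le

/-- The top window: `Σ_{⌊P^{0.502}/T⌋ < n ≤ ⌈P^{0.502}⌉} (n/φ(n))⁹/n ≤ e^{1024}(3 + 𝓛²)` (`𝓛 ≥ 3`).
[cite: Zhang2022LandauSiegel, §10 (10.5)] -/
theorem weight_top_le9 {D : ℕ} (hL : 3 ≤ ell D) :
    ∑ n ∈ Finset.Ioc ⌊bigP D ^ (0.502 : ℝ) / bigT D⌋₊ ⌈bigP D ^ (0.502 : ℝ)⌉₊,
        ((n : ℝ) / Nat.totient n) ^ 9 / n ≤ Real.exp 1024 * (3 + ell D ^ 2) := by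
  have hL1 : 1 ≤ ell D := by linarith
  have hT1 : 1 ≤ bigT D := one_le_bigT D (by linarith)
  have hT0 : 0 < bigT D := by linarith
  have hP0 : 0 < bigP D ^ (0.502 : ℝ) := Real.rpow_pos_of_pos (bigP_pos₉ D) _
  have hlo2 : (2 : ℝ) ≤ bigP D ^ (0.5 : ℝ) := by
    rw [bigP_rpow_eq]
    have h9 : (3 : ℝ) ^ 9 ≤ ell D ^ 9 := pow_le_pow_left₀ (by norm_num) hL 9
    have : (1 : ℝ) ≤ ell D ^ 9 * 0.5 := by nlinarith
    calc (2 : ℝ) ≤ 1 + 1 := by norm_num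
      _ ≤ (ell D ^ 9 * 0.5) + 1 := by linarith
      _ ≤ Real.exp (ell D ^ 9 * 0.5) := Real.add_one_le_exp _
  have hhi : bigP D ^ (0.5 : ℝ) ≤ bigP D ^ (0.502 : ℝ) / bigT D := by
    rw [le_div_iff₀ hT0, mul_comm]; exact bigT_mul_rpow_half_le hL
  have hY2 : (2 : ℝ) ≤ bigP D ^ (0.502 : ℝ) / bigT D := hlo2.trans hhi
  have hY : 0 < ⌊bigP D ^ (0.502 : ℝ) / bigT D⌋₊ := Nat.floor_pos.mpr (by linarith)
  have hYX : ⌊bigP D ^ (0.502 : ℝ) / bigT D⌋₊ ≤ ⌈bigP D ^ (0.502 : ℝ)⌉₊ := by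
    have h1 : (⌊bigP D ^ (0.502 : ℝ) / bigT D⌋₊ : ℝ) ≤ ⌈bigP D ^ (0.502 : ℝ)⌉₊ :=
      ((Nat.floor_le (by positivity)).trans (div_le_self hP0.le hT1)).trans (Nat.le_ceil _)
    exact_mod_cast h1
  refine (sum_ratio_pow_div_le 9 hY hYX).trans ?_
  have hlogY : Real.log (bigP D ^ (0.502 : ℝ) / bigT D / 2) ≤
      Real.log (⌊bigP D ^ (0.502 : ℝ) / bigT D⌋₊ : ℕ) := by
    refine Real.log_le_log (by positivity) ?_
    have := Nat.sub_one_lt_floor (bigP D ^ (0.502 : ℝ) / bigT D)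
    linarith
  have hlogX : Real.log (⌈bigP D ^ (0.502 : ℝ)⌉₊ : ℕ) ≤ Real.log (2 * bigP D ^ (0.502 : ℝ)) := by
    refine Real.log_le_log (by exact_mod_cast lt_of_lt_of_le hY hYX) ?_
    have := Nat.ceil_lt_add_one hP0.le
    have h1 : (1 : ℝ) ≤ bigP D ^ (0.502 : ℝ) := by
      have := hlo2.trans (hhi.trans (div_le_self hP0.le hT1)); linarith
    linarith
  rw [Real.log_div (div_pos hP0 hT0).ne' (by norm_num), Real.log_div hP0.ne' hT0.ne',
    log_bigT₉] at hlogY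
  rw [Real.log_mul (by norm_num) hP0.ne'] at hlogX
  have hlog2 : Real.log 2 ≤ 1 := by
    have := Real.log_two_lt_d9; linarith
  have hrpow : ell D ^ (1.1 : ℝ) ≤ ell D ^ 2 := by
    have h := Real.rpow_le_rpow_of_exponent_le hL1 (show (1.1 : ℝ) ≤ 2 by norm_num)
    rwa [Real.rpow_two] at h
  have h1024 : (2 : ℝ) ^ (9 + 1) = 1024 := by norm_num
  rw [h1024]
  have hlin : 1 + Real.log (⌈bigP D ^ (0.502 : ℝ)⌉₊ : ℕ) -
      Real.log (⌊bigP D ^ (0.502 : ℝ) / bigT D⌋₊ : ℕ) ≤ 3 + ell D ^ 2 := by linarith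
  exact mul_le_mul_of_nonneg_left hlin (Real.exp_pos _).le

/-- A single point: `Σ_{k−1 < n ≤ k} (n/φ(n))⁹/n ≤ 2e^{1024}` for `k ≥ 2`.
[cite: Zhang2022LandauSiegel, §10 (10.5)] -/
theorem weight_point_le9 {k : ℕ} (hk : 2 ≤ k) :
    ∑ n ∈ Finset.Ioc (k - 1) k, ((n : ℝ) / Nat.totient n) ^ 9 / n ≤ 2 * Real.exp 1024 := by
  have hY : 0 < k - 1 := by omega
  have hYX : k - 1 ≤ k := Nat.sub_le k 1
  refine (sum_ratio_pow_div_le 9 hY hYX).trans ?_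
  have hk1 : ((k - 1 : ℕ) : ℝ) = (k : ℝ) - 1 := by
    rw [Nat.cast_sub (by omega)]; norm_num
  have hkR : (2 : ℝ) ≤ k := by exact_mod_cast hk
  have hlog : Real.log (k : ℝ) - Real.log ((k - 1 : ℕ) : ℝ) ≤ Real.log 2 := by
    rw [hk1, ← Real.log_div (by linarith) (by linarith)]
    refine Real.log_le_log (div_pos (by linarith) (by linarith)) ?_
    rw [div_le_iff₀ (by linarith)]; linarith
  have hlog2 : Real.log 2 ≤ 1 := by
    have := Real.log_two_lt_d9; linarith
  have h1024 : (2 : ℝ) ^ (9 + 1) = 1024 := by norm_num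
  rw [h1024]
  have hlin : 1 + Real.log (k : ℝ) - Real.log ((k - 1 : ℕ) : ℝ) ≤ 2 := by linarith
  calc Real.exp 1024 * (1 + Real.log (k : ℝ) - Real.log ((k - 1 : ℕ) : ℝ))
      ≤ Real.exp 1024 * 2 := mul_le_mul_of_nonneg_left hlin (Real.exp_pos _).le
    _ = 2 * Real.exp 1024 := by ring

/-- The final scalar inequality at weight exponent `9`: `Sj1321Mid.final_le` with `K_g, K_e`
rescaled by `e^{768}` (`e^{1024} = e^{768}e^{256}`). [cite: Zhang2022LandauSiegel, §10 p. 58] -/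
theorem final_le9 {L Kg Ke ε : ℝ} (hL : 3 ≤ L) (hKg : 0 ≤ Kg) (hKe : 0 ≤ Ke) (hε : 0 < ε)
    (hLK : 4 * Real.exp 256 * (Real.exp 768 * Kg + Real.exp 768 * Ke) / (ε * π) + 1 ≤ L) :
    Kg * (L ^ 12)⁻¹ / (0.504 * L ^ 9) * (Real.exp 1024 * (2 + L ^ 9)) +
        Ke * (L ^ 3)⁻¹ / (0.504 * L ^ 9) * (2 * Real.exp 1024 + Real.exp 1024 * (3 + L ^ 2))
      ≤ ε * (π / L ^ 9) := by
  have h := final_le hL (Kg := Real.exp 768 * Kg) (Ke := Real.exp 768 * Ke) (by positivity)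
    (by positivity) hε hLK
  have he : Real.exp 1024 = Real.exp 768 * Real.exp 256 := by
    rw [← Real.exp_add]; norm_num
  rw [he]
  convert h using 1
  ring

/-! ## §3. The edge `Lemma101 → Lemma84Rel → Eq1043a` -/

/-- **`Z22:§10.u043` (first line) from Lemma 10.1 and the RELATIVE Lemma 8.4**: the middle-range
evaluation `Typed.Sec10B.Eq1043a c′` holds whenever the CLAIM node `Skeleton.Lemma101 c′`
(Lemma 10.1, a tree theorem for `c′ ≥ 0`: `Skeleton.lemma101_holds`) and the RELATIVE Lemma 8.4
`Skeleton.Lemma84Rel c′` hold — the manuscript's "By Lemma 10.1 and the results in Section 8" for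
the range `P^{0.5} ≤ dr < P^{0.502}`, every implicit estimate made explicit (error
`≤ 4e^{1024}(K_g + K_e)𝓛⁻¹⁰ ≤ εα` for `𝓛 ≥ 4e^{1024}(K_g+K_e)/(επ) + 1`, `𝓛 ≥ 200`,
`𝓛 ≥ 5π|c′| + 1`; `K_g, K_e` explicit in the constants `C₁, C₂` of Lemmas 10.1/8.4). Same proof as
the absolute edge `eq1043a_of`, with Lemma 8.4's error carrying `(dr/φ(dr))²` and the window
weights `Σ(n/φ(n))⁹/n`. [cite: Zhang2022LandauSiegel, §10 p. 58] -/
theorem eq1043a_of_rel (c' : ℝ) (h101 : Lemma101 c') (h84 : Lemma84Rel c') : Eq1043a c' := by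
  obtain ⟨c₁, -, C₁, D₁, h₁⟩ := h101
  obtain ⟨C₂, D₂, h₂⟩ := h84
  intro ε hε
  -- constants
  set Kg : ℝ := |C₁| * (|C₂| + 146) + 1000 * |C₂| with hKg
  set Ke : ℝ := (|C₁| + 1000) * (|C₂| + 146) + 1000 * |C₂| with hKe
  have hKg0 : 0 ≤ Kg := by positivity
  have hKe0 : 0 ≤ Ke := by positivity
  set L₀ : ℝ := max 200 (max (5 * π * |c'| + 1)
    (4 * Real.exp 256 * (Real.exp 768 * Kg + Real.exp 768 * Ke) / (ε * π) + 1)) with hL₀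
  refine ⟨max (max D₁ D₂) ⌈Real.exp L₀⌉₊, fun D _ χ hD hq hp hA j hj => ?_⟩
  -- thresholds
  have hD₁ : D₁ ≤ D := le_trans (le_trans (le_max_left _ _) (le_max_left _ _)) hD
  have hD₂ : D₂ ≤ D := le_trans (le_trans (le_max_right _ _) (le_max_left _ _)) hD
  have hL : L₀ ≤ ell D := le_ell_of_ceil_exp_le₄ (le_trans (le_max_right _ _) hD)
  have hL200 : 200 ≤ ell D := le_trans (le_max_left _ _) hL
  have hLc : 5 * π * |c'| + 1 ≤ ell D :=
    le_trans (le_trans (le_max_left _ _) (le_max_right _ _)) hL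
  have hLK : 4 * Real.exp 256 * (Real.exp 768 * Kg + Real.exp 768 * Ke) / (ε * π) + 1 ≤ ell D :=
    le_trans (le_trans (le_max_right _ _) (le_max_right _ _)) hL
  have hL3 : 3 ≤ ell D := by linarith
  have hLpos : 0 < ell D := by linarith
  have hL1 : 1 ≤ ell D := by linarith
  -- `α = π𝓛⁻⁹` and the `c′`-condition of the `β`-bounds
  have hα : alpha D = π / ell D ^ 9 := by rw [alpha, bigP, Real.log_exp]
  have hc : 5 * |c'| * alpha D * ell D ≤ 1 := by
    rw [hα]
    have h8 : ell D ≤ ell D ^ 8 := le_self_pow₀ hL1 (by norm_num)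
    have h1 : 5 * |c'| * (π / ell D ^ 9) * ell D = 5 * π * |c'| / ell D ^ 8 := by
      field_simp
    rw [h1, div_le_one (by positivity)]
    nlinarith [Real.pi_pos, abs_nonneg c']
  -- the two lemmas at this `D, χ, j`
  have h₁' := h₁ D χ hD₁ hq hp hA j hj
  have h₂' := h₂ D χ hD₂ hq hp hA j hj 6 (by simp)
  have hL' : ‖deriv χ.LFunction 1‖ ≤ ell D ^ 3 := norm_derivL_one_le_cube χ hp hL200
  -- positivity of the basic parameters
  have hP : 0 < bigP D := bigP_pos₉ D
  have hP5 : 0 < bigP D ^ (0.5 : ℝ) := Real.rpow_pos_of_pos hP _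
  have hP2 : 0 < bigP D ^ (0.502 : ℝ) := Real.rpow_pos_of_pos hP _
  have hT1 : 1 < bigT D := by
    have h11 : 0 < ell D ^ (1.1 : ℝ) := Real.rpow_pos_of_pos hLpos _
    have := Real.add_one_lt_exp h11.ne'
    rw [Skeleton.bigT]; linarith
  have hT0 : 0 < bigT D := by linarith
  have hlP1 : Real.log (Skeleton.P1 D) = 0.504 * ell D ^ 9 := by
    rw [Skeleton.P1, Real.log_rpow hP, bigP, Real.log_exp]
  have hlP1pos : 0 < Real.log (Skeleton.P1 D) := by rw [hlP1]; positivity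
  -- the exact layer
  rw [drSum_sub_main_eq c' χ hq hL3 j]
  -- abbreviations
  set e₂ : ℝ := |C₂| * (ell D ^ 6)⁻¹ with he₂
  set A : ℝ := 1000 * ell D ^ 3 / ell D ^ 9 with hAdef
  set Bg : ℝ := (|C₁| * (ell D ^ 15)⁻¹ * (e₂ + 146 * ell D ^ 3) + A * e₂) /
    Real.log (Skeleton.P1 D) with hBg
  set Be : ℝ := ((|C₁| * (ell D ^ 7)⁻¹ + A) * (e₂ + 146 * ell D ^ 3) + A * e₂) /
    Real.log (Skeleton.P1 D) with hBe
  have he₂0 : 0 ≤ e₂ := by positivity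
  have hA0 : 0 ≤ A := by positivity
  have hBg0 : 0 ≤ Bg := by positivity
  have hBe0 : 0 ≤ Be := by positivity
  set good : ℕ → Prop := fun n => bigP D ^ (0.5 : ℝ) < (n : ℝ) ∧
    (n : ℝ) ≤ bigP D ^ (0.502 : ℝ) / bigT D with hgood
  -- **the per-`n` bound**
  have key : ∀ n ∈ (Finset.Ico 1 (Nsupp D)).filter
      (fun n : ℕ => bigP D ^ (0.5 : ℝ) ≤ (n : ℝ) ∧ (n : ℝ) < bigP D ^ (0.502 : ℝ)),
      ‖∑ r ∈ n.divisors, drWeight c' χ j (n / r) r *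
          (mSum13 c' χ j n * nSum21 c' χ j (n / r) r -
            (500 * deriv χ.LFunction 1 / Real.log (bigP D) *
                (-1 - betaJ c' D j * (Real.log (n / bigP D ^ (0.5 : ℝ)) : ℂ))) *
              (deriv χ.LFunction 1 * PiW χ (n / r) r *
                frakgW c' D j 6 (Skeleton.P1 D / (n : ℝ)) / (Real.log (Skeleton.P1 D) : ℂ)))‖ ≤
        ((n : ℝ) / Nat.totient n) ^ 9 / n * (if good n then Bg else Be) := by
    intro n hn
    rw [Finset.mem_filter, Finset.mem_Ico] at hn
    obtain ⟨⟨hn1, -⟩, hlo, hhi⟩ := hn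
    have hn0 : n ≠ 0 := by omega
    -- the relative error of Lemma 8.4 at this `n`: `e₂ρ(n)²`, `ρ(n) = n/φ(n)`
    set ρ2 : ℝ := ((n : ℝ) / Nat.totient n) ^ 2 with hρ2
    have hρ2_1 : 1 ≤ ρ2 := one_le_pow₀ (one_le_self_div_totient hn0)
    have hρ2_0 : 0 ≤ ρ2 := zero_le_one.trans hρ2_1
    have he₂n0 : 0 ≤ e₂ * ρ2 := mul_nonneg he₂0 hρ2_0
    obtain ⟨hx1, hx4, hTx, hxP, hnT⟩ := midRange_facts hL3 hlo hhi
    -- sizes of the main values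
    have hg : ‖frakgW c' D j 6 (Skeleton.P1 D / (n : ℝ))‖ ≤ 146 :=
      norm_frakgW_six_le c' hLpos hc j hx1 hx4
    have hm₁ : ‖500 * deriv χ.LFunction 1 / Real.log (bigP D) *
        (-1 - betaJ c' D j * (Real.log (n / bigP D ^ (0.5 : ℝ)) : ℂ))‖ ≤ A := by
      refine (norm_mainV1_le c' χ hLpos hc j hlo hhi.le).trans ?_
      rw [hAdef]
      gcongr
    -- the `n`-sums: Lemma 8.4 at `x = P₁/n`, `(d, r) = (n/r, r)`
    have hN : ∀ r ∈ n.divisors, nSum21 c' χ j (n / r) r =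
        (1 / (Real.log (Skeleton.P1 D) : ℂ)) *
          ∑ m ∈ Finset.Ico 1 ⌈Skeleton.P1 D / (n : ℝ)⌉₊,
            χ (m : ZMod D) * xiZero c' D j m (n / r) r / (m : ℂ) *
              (((Skeleton.P1 D / (n : ℝ)) / m : ℝ) : ℂ) ^ (-betaMu D 6) *
              (Real.log ((Skeleton.P1 D / (n : ℝ)) / m) : ℂ) := by
      intro r hr
      have hrn : n / r * r = n := Nat.div_mul_cancel (Nat.dvd_of_mem_divisors hr)
      have hd1 : 1 ≤ n / r := Nat.div_pos (Nat.divisor_le hr) (Nat.pos_of_mem_divisors hr)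
      have hr1 : 1 ≤ r := Nat.pos_of_mem_divisors hr
      have hlo' : bigP D ^ (0.5 : ℝ) ≤ ((n / r * r : ℕ) : ℝ) := by rw [hrn]; exact hlo
      have h := nSum21_eq c' χ hL3 j hd1 hr1 hlo'
      rw [hrn] at h
      exact h
    have h2 : ∀ r ∈ n.divisors,
        ‖(∑ m ∈ Finset.Ico 1 ⌈Skeleton.P1 D / (n : ℝ)⌉₊,
            χ (m : ZMod D) * xiZero c' D j m (n / r) r / (m : ℂ) *
              (((Skeleton.P1 D / (n : ℝ)) / m : ℝ) : ℂ) ^ (-betaMu D 6) *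
              (Real.log ((Skeleton.P1 D / (n : ℝ)) / m) : ℂ)) -
          deriv χ.LFunction 1 * PiW χ (n / r) r * frakgW c' D j 6 (Skeleton.P1 D / (n : ℝ))‖
          ≤ e₂ * ρ2 := by
      intro r hr
      have hrn : n / r * r = n := Nat.div_mul_cancel (Nat.dvd_of_mem_divisors hr)
      have hd1 : 1 ≤ n / r := Nat.div_pos (Nat.divisor_le hr) (Nat.pos_of_mem_divisors hr)
      have hr1 : 1 ≤ r := Nat.pos_of_mem_divisors hr
      have hdrT : ((n / r * r : ℕ) : ℝ) < bigP D / bigT D ^ 2 := by rw [hrn]; exact hnT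
      have h := h₂' (n / r) r hd1 hr1 hdrT (Skeleton.P1 D / (n : ℝ)) hTx hxP
      refine h.trans ?_
      rw [hrn, prod_one_sub_inv_inv_sq_eq hn0, he₂, hρ2]
      gcongr
      · exact le_abs_self _
    -- the `m`-sum: Lemma 10.1, by cases on the position of `n`
    by_cases hgn : good n
    · rw [if_pos hgn]
      have h1 : ‖mSum13 c' χ j n - 500 * deriv χ.LFunction 1 / Real.log (bigP D) *
          (-1 - betaJ c' D j * (Real.log (n / bigP D ^ (0.5 : ℝ)) : ℂ))‖ ≤
          |C₁| * (ell D ^ 15)⁻¹ := by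
        rw [mSum13_eq_frakv1 c' χ hL3 j hlo]
        refine ((h₁' n).2.1 hgn.1 hgn.2).trans ?_
        exact mul_le_mul_of_nonneg_right (le_abs_self _) (by positivity)
      have := norm_sum_divisors_le c' χ j hn0 (mSum13 c' χ j n) _ _ _ he₂n0 (by positivity)
        hlP1pos h1 hm₁ hg hL' hN h2
      refine this.trans ?_
      rw [hBg]
      exact per_n_scale hρ2.symm hρ2_1 (zero_le_one.trans (one_le_self_div_totient hn0))
        (by positivity) (by positivity) (by positivity) hlP1pos
    · rw [if_neg hgn]
      -- edge: `|𝔳₁ⱼ(n)| ≤ C₁𝓛⁻⁷` by (10.5), and `|M − m₁| ≤ |M| + |m₁|`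
      have hwin : (bigP D ^ (0.5 : ℝ) / bigT D < (n : ℝ) ∧ (n : ℝ) ≤ bigP D ^ (0.5 : ℝ)) ∨
          (bigP D ^ (0.502 : ℝ) / bigT D < (n : ℝ) ∧ (n : ℝ) ≤ bigP D ^ (0.502 : ℝ)) ∨
          (bigP D ^ (0.504 : ℝ) / bigT D < (n : ℝ) ∧ (n : ℝ) < bigP D ^ (0.504 : ℝ)) := by
        rw [hgood] at hgn
        rcases not_and_or.mp hgn with h | h
        · left
          refine ⟨?_, not_lt.mp h⟩
          have : bigP D ^ (0.5 : ℝ) / bigT D < bigP D ^ (0.5 : ℝ) := div_lt_self hP5 hT1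
          linarith
        · right; left
          exact ⟨not_le.mp h, hhi.le⟩
      have hv : ‖frakv1 c' χ j (n : ℝ)‖ ≤ |C₁| * (ell D ^ 7)⁻¹ :=
        ((h₁' n).2.2.2 hwin).trans (mul_le_mul_of_nonneg_right (le_abs_self _) (by positivity))
      have h1 : ‖mSum13 c' χ j n - 500 * deriv χ.LFunction 1 / Real.log (bigP D) *
          (-1 - betaJ c' D j * (Real.log (n / bigP D ^ (0.5 : ℝ)) : ℂ))‖ ≤
          |C₁| * (ell D ^ 7)⁻¹ + A := by
        rw [mSum13_eq_frakv1 c' χ hL3 j hlo]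
        exact (norm_sub_le _ _).trans (add_le_add hv hm₁)
      have := norm_sum_divisors_le c' χ j hn0 (mSum13 c' χ j n) _ _ _ he₂n0 (by positivity)
        hlP1pos h1 hm₁ hg hL' hN h2
      refine this.trans ?_
      rw [hBe]
      exact per_n_scale hρ2.symm hρ2_1 (zero_le_one.trans (one_le_self_div_totient hn0))
        (by positivity) (by positivity) (by positivity) hlP1pos
  -- **summation over the range**
  set S := (Finset.Ico 1 (Nsupp D)).filter
      (fun n : ℕ => bigP D ^ (0.5 : ℝ) ≤ (n : ℝ) ∧ (n : ℝ) < bigP D ^ (0.502 : ℝ)) with hS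
  set w : ℕ → ℝ := fun n => ((n : ℝ) / Nat.totient n) ^ 9 / n with hw
  have hw0 : ∀ n, 0 ≤ w n := fun n => by rw [hw]; positivity
  -- weights of the good part and of the edge part
  have hWg : ∑ n ∈ S.filter good, w n ≤ Real.exp 1024 * (2 + ell D ^ 9) := by
    refine le_trans (Finset.sum_le_sum_of_subset_of_nonneg ?_ fun n _ _ => hw0 n)
      (weight_good_le9 hL3)
    intro n hn
    rw [Finset.mem_filter] at hn
    obtain ⟨-, hg1, hg2⟩ := hn
    rw [Finset.mem_Ioc]
    exact ⟨(Nat.floor_lt hP5.le).mpr hg1, Nat.le_floor hg2⟩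
  have hWe : ∑ n ∈ S.filter (fun n => ¬ good n), w n ≤
      2 * Real.exp 1024 + Real.exp 1024 * (3 + ell D ^ 2) := by
    have hlo2 : (1 : ℝ) < bigP D ^ (0.5 : ℝ) := by
      have hP1' : 1 < bigP D := by
        have h9 : 0 < ell D ^ 9 := by positivity
        have := Real.add_one_lt_exp h9.ne'
        rw [bigP]; linarith
      exact Real.one_lt_rpow hP1' (by norm_num)
    set k : ℕ := ⌈bigP D ^ (0.5 : ℝ)⌉₊ with hk
    have hk2 : 2 ≤ k := by
      have : 1 < k := Nat.lt_ceil.mpr (by exact_mod_cast hlo2)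
      omega
    set A₁ := Finset.Ioc (k - 1) k with hA₁
    set B₁ := Finset.Ioc ⌊bigP D ^ (0.502 : ℝ) / bigT D⌋₊ ⌈bigP D ^ (0.502 : ℝ)⌉₊ with hB₁
    have hsub : S.filter (fun n => ¬ good n) ⊆ A₁ ∪ B₁ := by
      intro n hn
      rw [Finset.mem_filter, hS, Finset.mem_filter, Finset.mem_Ico] at hn
      obtain ⟨⟨⟨hn1, -⟩, hlo, hhi⟩, hng⟩ := hn
      rw [Finset.mem_union]
      rcases not_and_or.mp hng with h | h
      · left
        have heq : (n : ℝ) = bigP D ^ (0.5 : ℝ) := le_antisymm (not_lt.mp h) hlo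
        have hkn : k = n := by rw [hk, ← heq, Nat.ceil_natCast]
        rw [hA₁, Finset.mem_Ioc, hkn]
        omega
      · right
        rw [hB₁, Finset.mem_Ioc]
        refine ⟨(Nat.floor_lt (by positivity)).mpr (not_le.mp h), ?_⟩
        exact Nat.cast_le.mp ((hhi.le).trans (Nat.le_ceil _))
    have hAB := Finset.sum_union_inter (s₁ := A₁) (s₂ := B₁) (f := w)
    have hA := weight_point_le9 hk2
    have hB := weight_top_le9 (D := D) hL3
    have hI : 0 ≤ ∑ n ∈ A₁ ∩ B₁, w n := Finset.sum_nonneg fun n _ => hw0 n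
    calc ∑ n ∈ S.filter (fun n => ¬ good n), w n ≤ ∑ n ∈ A₁ ∪ B₁, w n :=
          Finset.sum_le_sum_of_subset_of_nonneg hsub fun n _ _ => hw0 n
      _ ≤ ∑ n ∈ A₁, w n + ∑ n ∈ B₁, w n := by linarith
      _ ≤ 2 * Real.exp 1024 + Real.exp 1024 * (3 + ell D ^ 2) := add_le_add hA hB
  -- assemble
  calc ‖∑ n ∈ S, ∑ r ∈ n.divisors, drWeight c' χ j (n / r) r *
          (mSum13 c' χ j n * nSum21 c' χ j (n / r) r -
            (500 * deriv χ.LFunction 1 / Real.log (bigP D) *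
                (-1 - betaJ c' D j * (Real.log (n / bigP D ^ (0.5 : ℝ)) : ℂ))) *
              (deriv χ.LFunction 1 * PiW χ (n / r) r *
                frakgW c' D j 6 (Skeleton.P1 D / (n : ℝ)) / (Real.log (Skeleton.P1 D) : ℂ)))‖
      ≤ ∑ n ∈ S, ‖∑ r ∈ n.divisors, drWeight c' χ j (n / r) r *
          (mSum13 c' χ j n * nSum21 c' χ j (n / r) r -
            (500 * deriv χ.LFunction 1 / Real.log (bigP D) *
                (-1 - betaJ c' D j * (Real.log (n / bigP D ^ (0.5 : ℝ)) : ℂ))) *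
              (deriv χ.LFunction 1 * PiW χ (n / r) r *
                frakgW c' D j 6 (Skeleton.P1 D / (n : ℝ)) / (Real.log (Skeleton.P1 D) : ℂ)))‖ :=
        norm_sum_le _ _
    _ ≤ ∑ n ∈ S, w n * (if good n then Bg else Be) := Finset.sum_le_sum key
    _ = ∑ n ∈ S.filter good, w n * Bg + ∑ n ∈ S.filter (fun n => ¬ good n), w n * Be := by
        simp_rw [mul_ite]
        rw [Finset.sum_ite]
    _ = Bg * ∑ n ∈ S.filter good, w n + Be * ∑ n ∈ S.filter (fun n => ¬ good n), w n := by
        rw [← Finset.sum_mul, ← Finset.sum_mul]; ring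
    _ ≤ Bg * (Real.exp 1024 * (2 + ell D ^ 9)) +
          Be * (2 * Real.exp 1024 + Real.exp 1024 * (3 + ell D ^ 2)) := by
        gcongr
    _ ≤ Kg * (ell D ^ 12)⁻¹ / (0.504 * ell D ^ 9) * (Real.exp 1024 * (2 + ell D ^ 9)) +
          Ke * (ell D ^ 3)⁻¹ / (0.504 * ell D ^ 9) *
            (2 * Real.exp 1024 + Real.exp 1024 * (3 + ell D ^ 2)) := by
        have hBg' : Bg ≤ Kg * (ell D ^ 12)⁻¹ / (0.504 * ell D ^ 9) := by
          rw [hBg, hlP1]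
          exact div_le_div_of_nonneg_right (coeff_good_le hL1 C₁ C₂) (by positivity)
        have hBe' : Be ≤ Ke * (ell D ^ 3)⁻¹ / (0.504 * ell D ^ 9) := by
          rw [hBe, hlP1]
          exact div_le_div_of_nonneg_right (coeff_edge_le hL1 C₁ C₂) (by positivity)
        gcongr
    _ ≤ ε * (π / ell D ^ 9) := final_le9 hL3 hKg0 hKe0 hε hLK
    _ = ε * alpha D := by rw [hα]

/-- **`Z22:§10.u043` (first line) from the relative Lemma 8.4 alone**, for `c′ ≥ 0` (Lemma 10.1 is
the tree theorem `Skeleton.lemma101_holds`). [cite: Zhang2022LandauSiegel, §10 p. 58] -/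
theorem eq1043a_of_lemma84Rel {c' : ℝ} (hc' : 0 ≤ c') (h84 : Lemma84Rel c') : Eq1043a c' :=
  eq1043a_of_rel c' (lemma101_holds hc') h84

end Literature.NumberTheory.LFunctions.Zhang2022.Sj1321Mid
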